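import Summits.CriticalPhenomena.PercolationContinuityZ3.Theorems.Transplant.SkelPhiRootChainN
import Summits.CriticalPhenomena.PercolationContinuityZ3.Theorems.Transplant.SkelRootChainW3
import HarnessLib

/-!
# N1 (the `{±1}` node), (R) column (NEG-SCOPE B.17, y′-family v3): THE ROOT RESIDUE FROM THE BRIDGE + TWO RUNS FOR ANY SCHEME —
# `Skelφ.rootOblTWAt_of_bridgeG3`: the three-leg twin of `rootOblTWAt_of_bridgeG` (p292148): hop (the root's long x side-half, side `σ`) → bridge (one step in the root
# frame `rootFrame φ t σ`, `BridgePrm`) → a FIRST run read through a planar map `ψ₂` over a route-free frame `S₂` (the x-run prefix) → a SECOND run through `ψ₃` over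
# `S₃` (the y′-run), two cross links (bridge core `1` into `S₂.core 0`; `S₂.core (S₂.N+1)` into `S₃.core 0`), every region inside the root world and x-clear of the
# pinned seed (`kb < rootFrame φ t σ w 0`), last core of `S₃` inside the target box; assembled by `Skel.rootOblTWAt_of_chain₃`.  Scheme-generic (`S : KSchA V ℕ`,
# footprint tests `FootOK`/`TgtOK`).

WHY (located (L-R4), lane INBOX 2026-08-21T19:47Z): for a vertical direction the y′-run cannot start next to the seed (its first link regions contain the root);
an x-run prefix of a few strides moves the chain `≈ 4 n_L` sideways first, after which every y′-region is x-clear of the seed.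

builds on p205010 (kernel theorem, internal audit signed; external expert review pending) — nothing in this file uses p205010; nothing here is a claim about the open node.
Lane `prim-bschramm`, seat `prim-bschramm-p3` (gen 10; design owner + (R) owner); helper file (`--supports stmt-CriticalPhenomena-4575 --as helper`).
[cite: KozmaNitzan2024, §4 p. 27 (G₀), p. 28 ((32) at the root), Lemma 11 (pp. 22–23), Lemma 12 (pp. 23–25)] [cite: MartineauTassion2017, §3.2, §4.3]
-/

noncomputable section

open MeasureTheory ProbabilityTheory
open scoped ENNReal Classical

namespace Summit.CriticalPhenomena.PercolationContinuityZ3.Theorems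

namespace Transplant

namespace Skelφ

open Literature.Probability.Percolation Literature.Probability.LatticeModels SimpleGraph GadgetSystem ProbeHistory HSiteScheme Contour KNCells
open Literature.Probability.Percolation.KozmaNitzan.Cells (oth sgOf stepVec_apply_fst)
open KNCells.KSchA KNLevels ChainPlanar
open Literature.Barriers.CriticalPhenomena (graphBall mem_graphBall_self graphBall_mono)
open BoxProdZ2 (ConcRadiiG)
open Skel (winGraph RootOblTWAt)

variable {V : Type} [DecidableEq V] [Countable V] {G : SimpleGraph V} [G.LocallyFinite] {φ ψ₂ ψ₃ : V → Site 2}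

/-- **THE ROOT RESIDUE AT ONE DIRECTION FROM THE BRIDGE AND TWO RUNS, FOR ANY SCHEME** `S : KSchA V ℕ` (root `t`, density `S.p`): hop → bridge (root frame, side `σ`)
→ run `S₂` through `ψ₂` → run `S₃` through `ψ₃`; the footprint tests `FootOK`/`TgtOK` read vertices of the window ball into the root world `S.U0root du` resp. the target
box `S.Γ.M a₀ (0 + du)`; every region is x-clear of the pinned seed. [cite: KozmaNitzan2024, §4 p. 28 ((32) at the root), Lemma 11 (pp. 22–23), Lemma 12 (pp. 23–25)] -/
theorem rootOblTWAt_of_bridgeG3 (hlipφ : Lip G φ) (hlip₂ : Lip G ψ₂) (hlip₃ : Lip G ψ₃)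
    (S : KSchA V ℕ) {t : V} (hroot : S.Γ.root = t) (du : MDir) {σ : ℤ} (hσ : σ = 1 ∨ σ = -1) {Rπ : ℕ}
    -- the scheme's membership tests: footprints in the world, in the target box
    (FootOK TgtOK : V → Prop) (hUfoot : ∀ w ∈ graphBall G t Rπ, FootOK w → w ∈ S.U0root du)
    (hMfoot : ∀ w ∈ graphBall G t Rπ, TgtOK w → w ∈ S.Γ.M S.Γ.a₀ ((0 : Site 2) + stepVec du))
    -- the pinned seed
    {A : Finset V} (htA : t ∈ A) (hAconn : ∀ a ∈ A, PathIn G (↑A : Set V) t a) (hAπ : ∀ a ∈ A, a ∈ graphBall G t Rπ)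
    (hAQ : A ⊆ S.Γ.Q S.Γ.a₀ 0)
    {kb : ℕ} (hAk : ∀ a ∈ A, |rootFrame φ t σ a 0| ≤ kb)
    -- the three frames and the chain data
    (B : BridgePrm) (hB : BridgeOK B) (S₂ S₃ : SchedFrame) (P₁ P₂ P₃ : WinChainData V)
    (hPo₁ : P₁.o = t) (hPo₂ : P₂.o = t) (hPo₃ : P₃.o = t)
    (hPS₁ : P₁.Sfin = (S.U0root du).filter fun y => y ∈ graphBall G t Rπ)
    (hPS₂ : P₂.Sfin = (S.U0root du).filter fun y => y ∈ graphBall G t Rπ)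
    (hPS₃ : P₃.Sfin = (S.U0root du).filter fun y => y ∈ graphBall G t Rπ)
    (hRim₁ : ∀ k, P₁.Rim k ⊆ (planarWindowWin (lip_rootFrame hlipφ t hσ) t Rπ).stepDF (B.bridgeFrame hB) k)
    (hRim₂ : ∀ k, P₂.Rim k ⊆ (planarWindowWin hlip₂ t Rπ).stepDF S₂ k)
    (hRim₃ : ∀ k, P₃.Rim k ⊆ (planarWindowWin hlip₃ t Rπ).stepDF S₃ k)
    (hRl₁ : P₁.Rlev + 1 ≤ B.R') (hRl₂ : P₂.Rlev + 1 ≤ S₂.R') (hRl₃ : P₃.Rlev + 1 ≤ S₃.R')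
    (hj₁ : P₁.j₁ ≤ P₁.Rlev) (hj₂ : P₂.j₁ ≤ P₂.Rlev) (hj₃ : P₃.j₁ ≤ P₃.Rlev)
    -- rooms: footprints of the regions and of the last core, clearances, nonempty targets, the two cross links
    (hfoot₁ : ∀ w ∈ graphBall G t Rπ, rootFrame φ t σ w ∈ Finset.Icc B.regionLo B.regionHi → FootOK w)
    (hfoot₂ : ∀ k ≤ S₂.N, ∀ w ∈ graphBall G t Rπ, ψ₂ w ∈ S₂.region k → FootOK w)
    (hfoot₃ : ∀ k ≤ S₃.N, ∀ w ∈ graphBall G t Rπ, ψ₃ w ∈ S₃.region k → FootOK w)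
    (hclear₁ : (kb : ℤ) < B.B₀lo 0 - B.R' - B.pr)
    (hclear₂ : ∀ k ≤ S₂.N, ∀ w ∈ graphBall G t Rπ, ψ₂ w ∈ S₂.region k → (kb : ℤ) < rootFrame φ t σ w 0)
    (hclear₃ : ∀ k ≤ S₃.N, ∀ w ∈ graphBall G t Rπ, ψ₃ w ∈ S₃.region k → (kb : ℤ) < rootFrame φ t σ w 0)
    (hTne₁ : (Win G (rootFrame φ t σ) t (Finset.Icc B.core1Lo B.core1Hi) Rπ).Nonempty)
    (hTne₂ : ∀ k ≤ S₂.N, (Win G ψ₂ t (S₂.core (k + 1)) Rπ).Nonempty)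
    (hTne₃ : ∀ k ≤ S₃.N, (Win G ψ₃ t (S₃.core (k + 1)) Rπ).Nonempty)
    (hx₁₂ : ∀ w ∈ graphBall G t Rπ, rootFrame φ t σ w ∈ Finset.Icc B.core1Lo B.core1Hi → ψ₂ w ∈ S₂.core 0)
    (hx₂₃ : ∀ w ∈ graphBall G t Rπ, ψ₂ w ∈ S₂.core (S₂.N + 1) → ψ₃ w ∈ S₃.core 0)
    (hlastf : ∀ w ∈ graphBall G t Rπ, ψ₃ w ∈ S₃.core (S₃.N + 1) → TgtOK w)
    -- the hop: one link input valid for `P_q`, its prism inside the ball with root-world footprints, its target inside the hop box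
    {Δ' : ℕ} {δr : ℕ → ℝ} {η : ℝ} {Qp T₀ : Finset V}
    (hlink : 1 - δr (0 + 1 + S₂.N + 1 + S₃.N) < (bondPercolation G S.p).real (linkIn (↑Qp : Set V) A T₀))
    (hQπ : ∀ w ∈ Qp, w ∈ graphBall G t Rπ) (hQfoot : ∀ w ∈ Qp, FootOK w)
    (hT₀ : ∀ w ∈ T₀, w ∈ graphBall G t Rπ ∧ rootFrame φ t σ w ∈ Finset.Icc B.B₀lo B.B₀hi)
    -- analytic inputs under the root-seed law (kits, counts, rim excesses) at accuracy `δr n`, `n = 1 + S₂.N + 1 + S₃.N`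
    (hcount₁ : 1 / (1 - (S.p : ℝ)) ^ (Δ' * P₁.N) ≤ δr (0 + 1 + S₂.N + 1 + S₃.N) * ((Finset.Icc P₁.j₀ P₁.j₁).card : ℝ))
    (hcount₂ : 1 / (1 - (S.p : ℝ)) ^ (Δ' * P₂.N) ≤ δr (0 + 1 + S₂.N + 1 + S₃.N) * ((Finset.Icc P₂.j₀ P₂.j₁).card : ℝ))
    (hcount₃ : 1 / (1 - (S.p : ℝ)) ^ (Δ' * P₃.N) ≤ δr (0 + 1 + S₂.N + 1 + S₃.N) * ((Finset.Icc P₃.j₀ P₃.j₁).card : ℝ))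
    (hkits₁ : ∀ k ≤ (B.bridgeFrame hB).N, ∀ j ∈ Finset.Icc P₁.j₀ P₁.j₁, ∃ (σk : SData V) (Sz : Finset V),
      SHyp (P₁.stepLF (planarWindowWin (lip_rootFrame hlipφ t hσ) t Rπ) (B.bridgeFrame hB) k) j σk ∧ σk.N ≤ P₁.N ∧
      (1 - (S.p : ℝ) ^ σk.sB) ^ σk.k ≤ δr (0 + 1 + S₂.N + 1 + S₃.N) ∧ Sz ⊆ (P₁.stepLF (planarWindowWin (lip_rootFrame hlipφ t hσ) t Rπ) (B.bridgeFrame hB) k).X j ∧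
      Sz ⊆ (planarWindowWin (lip_rootFrame hlipφ t hσ) t Rπ).stepDF (B.bridgeFrame hB) k ∧
      (∀ x ∈ σk.K, ∀ e' ∈ σk.seed x, e' ∉ wireSet (↑Sz : Set V)) ∧ (∀ x ∈ σk.K, σk.face x ⊆ Sz) ∧
      (∀ x ∈ σk.K, 1 - 3 * δr (0 + 1 + S₂.N + 1 + S₃.N) ≤
        (prodBernoulli (S.W0pin G (edgesIn G A)
          ((S.U0root du).filter fun y => y ∈ graphBall G t Rπ))).real
        {ω | ∃ u ∈ σk.face x, 1 - δr (0 + 1 + S₂.N + 1 + S₃.N) <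
          (prodBernoulli (pinW (S.W0pin G (edgesIn G A)
            ((S.U0root du).filter fun y => y ∈ graphBall G t Rπ)) (wireSet (↑Sz : Set V)) ω)).real
            (⋃ t' ∈ P₁.coreEF (planarWindowWin (lip_rootFrame hlipφ t hσ) t Rπ) (B.bridgeFrame hB) k,
              openConnIn (↑((planarWindowWin (lip_rootFrame hlipφ t hσ) t Rπ).stepDF (B.bridgeFrame hB) k) : Set V) u t')}))
    (hkits₂ : ∀ k ≤ S₂.N, ∀ j ∈ Finset.Icc P₂.j₀ P₂.j₁, ∃ (σk : SData V) (Sz : Finset V),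
      SHyp (P₂.stepLF (planarWindowWin hlip₂ t Rπ) S₂ k) j σk ∧ σk.N ≤ P₂.N ∧
      (1 - (S.p : ℝ) ^ σk.sB) ^ σk.k ≤ δr (0 + 1 + S₂.N + 1 + S₃.N) ∧ Sz ⊆ (P₂.stepLF (planarWindowWin hlip₂ t Rπ) S₂ k).X j ∧
      Sz ⊆ (planarWindowWin hlip₂ t Rπ).stepDF S₂ k ∧
      (∀ x ∈ σk.K, ∀ e' ∈ σk.seed x, e' ∉ wireSet (↑Sz : Set V)) ∧ (∀ x ∈ σk.K, σk.face x ⊆ Sz) ∧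
      (∀ x ∈ σk.K, 1 - 3 * δr (0 + 1 + S₂.N + 1 + S₃.N) ≤
        (prodBernoulli (S.W0pin G (edgesIn G A)
          ((S.U0root du).filter fun y => y ∈ graphBall G t Rπ))).real
        {ω | ∃ u ∈ σk.face x, 1 - δr (0 + 1 + S₂.N + 1 + S₃.N) <
          (prodBernoulli (pinW (S.W0pin G (edgesIn G A)
            ((S.U0root du).filter fun y => y ∈ graphBall G t Rπ)) (wireSet (↑Sz : Set V)) ω)).real
            (⋃ t' ∈ P₂.coreEF (planarWindowWin hlip₂ t Rπ) S₂ k, openConnIn (↑((planarWindowWin hlip₂ t Rπ).stepDF S₂ k) : Set V) u t')}))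
    (hkits₃ : ∀ k ≤ S₃.N, ∀ j ∈ Finset.Icc P₃.j₀ P₃.j₁, ∃ (σk : SData V) (Sz : Finset V),
      SHyp (P₃.stepLF (planarWindowWin hlip₃ t Rπ) S₃ k) j σk ∧ σk.N ≤ P₃.N ∧
      (1 - (S.p : ℝ) ^ σk.sB) ^ σk.k ≤ δr (0 + 1 + S₂.N + 1 + S₃.N) ∧ Sz ⊆ (P₃.stepLF (planarWindowWin hlip₃ t Rπ) S₃ k).X j ∧
      Sz ⊆ (planarWindowWin hlip₃ t Rπ).stepDF S₃ k ∧
      (∀ x ∈ σk.K, ∀ e' ∈ σk.seed x, e' ∉ wireSet (↑Sz : Set V)) ∧ (∀ x ∈ σk.K, σk.face x ⊆ Sz) ∧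
      (∀ x ∈ σk.K, 1 - 3 * δr (0 + 1 + S₂.N + 1 + S₃.N) ≤
        (prodBernoulli (S.W0pin G (edgesIn G A)
          ((S.U0root du).filter fun y => y ∈ graphBall G t Rπ))).real
        {ω | ∃ u ∈ σk.face x, 1 - δr (0 + 1 + S₂.N + 1 + S₃.N) <
          (prodBernoulli (pinW (S.W0pin G (edgesIn G A)
            ((S.U0root du).filter fun y => y ∈ graphBall G t Rπ)) (wireSet (↑Sz : Set V)) ω)).real
            (⋃ t' ∈ P₃.coreEF (planarWindowWin hlip₃ t Rπ) S₃ k, openConnIn (↑((planarWindowWin hlip₃ t Rπ).stepDF S₃ k) : Set V) u t')}))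
    (hη : η ≤ δr (0 + 1 + S₂.N + 1 + S₃.N) / 2)
    (hexc₁ : ∀ k ≤ (B.bridgeFrame hB).N, (prodBernoulli (S.W0pin G (edgesIn G A)
        ((S.U0root du).filter fun y => y ∈ graphBall G t Rπ))).real (⋃ t' ∈ P₁.Rim k, openConn t t') ≤ η)
    (hexc₂ : ∀ k ≤ S₂.N, (prodBernoulli (S.W0pin G (edgesIn G A)
        ((S.U0root du).filter fun y => y ∈ graphBall G t Rπ))).real (⋃ t' ∈ P₂.Rim k, openConn t t') ≤ η)
    (hexc₃ : ∀ k ≤ S₃.N, (prodBernoulli (S.W0pin G (edgesIn G A)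
        ((S.U0root du).filter fun y => y ∈ graphBall G t Rπ))).real (⋃ t' ∈ P₃.Rim k, openConn t t') ≤ η) :
    RootOblTWAt G S Δ' δr du := by
  subst hroot
  set t : V := S.Γ.root with htdef
  set 𝒲₁ := planarWindowWin (lip_rootFrame hlipφ t hσ) t Rπ with h𝒲₁
  set 𝒲₂ := planarWindowWin hlip₂ t Rπ with h𝒲₂
  set 𝒲₃ := planarWindowWin hlip₃ t Rπ with h𝒲₃
  set S₁ := B.bridgeFrame hB with hS₁
  -- footprints ⟹ the root world / the target box
  have hU : ∀ {w : V}, w ∈ graphBall G t Rπ → FootOK w → w ∈ (S.U0root du).filter fun y => y ∈ graphBall G t Rπ := by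
    intro w hw hf
    exact Finset.mem_filter.2 ⟨hUfoot _ hw hf, hw⟩
  -- regions of the bridge / the two runs: inside the world, off the seed
  have hDU₁ : ∀ k ≤ S₁.N, 𝒲₁.stepDF S₁ k ⊆ (S.U0root du).filter fun y => y ∈ graphBall G t Rπ := by
    intro k hk w hw
    obtain rfl : k = 0 := Nat.le_zero.1 hk
    change w ∈ Win G (rootFrame φ t σ) t (S₁.region 0) Rπ at hw
    rw [mem_Win] at hw
    exact hU hw.1 (hfoot₁ w hw.1 (by simpa [hS₁] using hw.2))
  have hDU₂ : ∀ k ≤ S₂.N, 𝒲₂.stepDF S₂ k ⊆ (S.U0root du).filter fun y => y ∈ graphBall G t Rπ := by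
    intro k hk w hw
    change w ∈ Win G ψ₂ t (S₂.region k) Rπ at hw
    rw [mem_Win] at hw
    exact hU hw.1 (hfoot₂ k hk w hw.1 hw.2)
  have hDU₃ : ∀ k ≤ S₃.N, 𝒲₃.stepDF S₃ k ⊆ (S.U0root du).filter fun y => y ∈ graphBall G t Rπ := by
    intro k hk w hw
    change w ∈ Win G ψ₃ t (S₃.region k) Rπ at hw
    rw [mem_Win] at hw
    exact hU hw.1 (hfoot₃ k hk w hw.1 hw.2)
  have hDA₁ : ∀ k ≤ S₁.N, Disjoint (𝒲₁.stepDF S₁ k) A := by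
    intro k hk
    obtain rfl : k = 0 := Nat.le_zero.1 hk
    change Disjoint (Win G (rootFrame φ t σ) t (S₁.region 0) Rπ) A
    refine Finset.disjoint_left.2 fun w hw hwA => ?_
    rw [mem_Win] at hw
    have h1 : B.B₀lo 0 - B.R' - B.pr ≤ rootFrame φ t σ w 0 := BridgePrm.le_of_mem_region (by simpa [hS₁] using hw.2) 0
    have h2 := (abs_le.1 (hAk w hwA)).2
    linarith
  have hDA₂ : ∀ k ≤ S₂.N, Disjoint (𝒲₂.stepDF S₂ k) A := by
    intro k hk
    change Disjoint (Win G ψ₂ t (S₂.region k) Rπ) A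
    refine Finset.disjoint_left.2 fun w hw hwA => ?_
    rw [mem_Win] at hw
    have h1 := hclear₂ k hk w hw.1 hw.2
    have h2 := (abs_le.1 (hAk w hwA)).2
    linarith
  have hDA₃ : ∀ k ≤ S₃.N, Disjoint (𝒲₃.stepDF S₃ k) A := by
    intro k hk
    change Disjoint (Win G ψ₃ t (S₃.region k) Rπ) A
    refine Finset.disjoint_left.2 fun w hw hwA => ?_
    rw [mem_Win] at hw
    have h1 := hclear₃ k hk w hw.1 hw.2
    have h2 := (abs_le.1 (hAk w hwA)).2
    linarith
  -- nonempty true targets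
  have hTne₁' : ∀ k ≤ S₁.N, (𝒲₁.coreTF S₁ k).Nonempty := by
    intro k hk
    obtain rfl : k = 0 := Nat.le_zero.1 hk
    change (Win G (rootFrame φ t σ) t (S₁.core (0 + 1)) Rπ).Nonempty
    simpa [hS₁] using hTne₁
  have hTne₂' : ∀ k ≤ S₂.N, (𝒲₂.coreTF S₂ k).Nonempty := fun k hk => hTne₂ k hk
  have hTne₃' : ∀ k ≤ S₃.N, (𝒲₃.coreTF S₃ k).Nonempty := fun k hk => hTne₃ k hk
  -- the two cross links and the last core
  have hx₁₂' : 𝒲₁.coreTF S₁ S₁.N ⊆ 𝒲₂.W (S₂.core 0) := by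
    intro w hw
    change w ∈ Win G (rootFrame φ t σ) t (S₁.core (S₁.N + 1)) Rπ at hw
    change w ∈ Win G ψ₂ t (S₂.core 0) Rπ
    rw [mem_Win] at hw ⊢
    exact ⟨hw.1, hx₁₂ w hw.1 (by simpa [hS₁] using hw.2)⟩
  have hx₂₃' : 𝒲₂.coreTF S₂ S₂.N ⊆ 𝒲₃.W (S₃.core 0) := by
    intro w hw
    change w ∈ Win G ψ₂ t (S₂.core (S₂.N + 1)) Rπ at hw
    change w ∈ Win G ψ₃ t (S₃.core 0) Rπ
    rw [mem_Win] at hw ⊢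
    exact ⟨hw.1, hx₂₃ w hw.1 hw.2⟩
  have hlast : 𝒲₃.coreTF S₃ S₃.N ⊆ S.Γ.M S.Γ.a₀ ((0 : Site 2) + stepVec du) := by
    intro w hw
    change w ∈ Win G ψ₃ t (S₃.core (S₃.N + 1)) Rπ at hw
    rw [mem_Win] at hw
    exact hMfoot w hw.1 (hlastf w hw.1 hw.2)
  -- the hop's prism inside the world, its target inside the first level
  have hQU : Qp ⊆ (S.U0root du).filter fun y => y ∈ graphBall G t Rπ := fun w hw => hU (hQπ w hw) (hQfoot w hw)
  have hT₀' : T₀ ⊆ 𝒲₁.W (S₁.core 0) := by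
    intro w hw
    obtain ⟨hπ, hbox⟩ := hT₀ w hw
    change w ∈ Win G (rootFrame φ t σ) t (S₁.core 0) Rπ
    rw [mem_Win]
    exact ⟨hπ, by simpa [hS₁] using hbox⟩
  have hN : S₁.N + 1 + S₂.N + 1 + S₃.N = 0 + 1 + S₂.N + 1 + S₃.N := by simp [hS₁]
  -- assemble
  refine Skel.rootOblTWAt_of_chain₃ (S := S) hAQ hAπ htA hAconn 𝒲₁ 𝒲₂ 𝒲₃ S₁ S₂ S₃ P₁ P₂ P₃ hPo₁ hPo₂ hPo₃ hPS₁ hPS₂ hPS₃ hRim₁ hRim₂ hRim₃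
    hRl₁ hRl₂ hRl₃ hj₁ hj₂ hj₃ hTne₁' hTne₂' hTne₃' hDU₁ hDU₂ hDU₃ hDA₁ hDA₂ hDA₃ hx₁₂' hx₂₃' hlast (hN ▸ hlink) hQU hT₀'
    (hN ▸ hcount₁) (hN ▸ hcount₂) (hN ▸ hcount₃) (hN ▸ hkits₁) (hN ▸ hkits₂) (hN ▸ hkits₃) (hN ▸ hη) hexc₁ hexc₂ hexc₃

end Skelφ

end Transplant

end Summit.CriticalPhenomena.PercolationContinuityZ3.Theorems

end
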